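import Literature.Computability.AlgebraicComplexity.ConstantFreeValiant
import HarnessLib

/-!
# The `(size, formal degree)` calculus of constant-free circuits (towards `VP⁰` membership proofs)

Companion of `ConstantFreeValiant.lean` (Bürgisser 2009, Def. 2.7: `VP⁰` = families computed by
fan-in-two, constant-free circuits of polynomially bounded SIZE and FORMAL DEGREE) and of the
`τ`-calculus of `ConstantFreeCircuits.lean` (which tracks size only). To prove that an explicitly
given family is in `VP⁰` one needs both measures at once; this file provides

* the formal degree of the circuit combinators: `formalDegree_add = max`, `formalDegree_mul = +`,
  `formalDegree_smul = id` (through `gateFormalDegrees_append_shift`, the formal-degree twin of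
  `gateValues_append_shift`);
* the predicate `HasTauDeg f s d` — "`f` has a fan-in-two constant-free circuit of size `≤ s` and
  formal degree `≤ d`" — and its closure rules: variables and sign constants `(0, 1)`, sums
  `(s₁ + s₂ + 1, max d₁ d₂)`, products `(s₁ + s₂ + 1, d₁ + d₂)`, negation `(s + 1, d)`, differences,
  `1 - f`, renaming, finite sums and products, monotonicity; and the bridge
  `HasTauDeg.constantFreeComplexity_le` (`τ f ≤ s`).

Formal degree (Bürgisser 2009, §2.2): inputs (variables, constants) have formal degree `1`, a sum
gate the maximum and a product gate the sum of the formal degrees of its operands.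

## References

* P. Bürgisser, *On defining integers and proving arithmetic circuit lower bounds*, Comput.
  Complexity 18 (2009) = ECCC TR06-113, §2.2, Def. 2.7.
* G. Malod, *Polynômes et coefficients*, PhD thesis, Lyon 2003 (`VP⁰`, formal degree).
* P. Bürgisser, *Completeness and Reduction in Algebraic Complexity Theory*, Springer 2000,
  Def. 2.1, proof of Prop. 2.3 (juxtaposition of circuits).
-/

noncomputable section

open MvPolynomial

namespace Literature.Computability.AlgebraicComplexity

universe u v w

namespace ArithCircuit

variable {k : Type u} {σ : Type v} {τ : Type w}

/-! ### Formal degrees under shifting, truncation and juxtaposition -/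

/-- A shifted operand read against `pre ++ degs` (shift `= |pre|`) has the formal degree it has
against `degs`. [cite: Burgisser2006, §2.2] -/
theorem Operand.formalDegree_shift_append (pre degs : List ℕ) (u : Operand k σ) :
    (u.shift pre.length).formalDegree (pre ++ degs) = u.formalDegree degs := by
  cases u with
  | var i => rfl
  | const c => rfl
  | gate j =>
    simp [Operand.shift, Operand.formalDegree, List.getD_eq_getElem?_getD,
      List.getElem?_append_right (Nat.le_add_left pre.length j)]

/-- A truncated operand ignores formal degrees appended after the truncation point (a junk
reference and the constant `0` it is truncated to both have formal degree `1`). [cite: Burgisser2006, §2.2] -/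
theorem Operand.formalDegree_truncate_append [Zero k] (degs ws : List ℕ) (u : Operand k σ) :
    (u.truncate degs.length).formalDegree (degs ++ ws) = u.formalDegree degs := by
  cases u with
  | var i => rfl
  | const c => rfl
  | gate j =>
    by_cases h : j < degs.length
    · simp [Operand.truncate, Operand.formalDegree, h, List.getD_eq_getElem?_getD,
        List.getElem?_append_left h]
    · simp [Operand.truncate, Operand.formalDegree, h, List.getD_eq_getElem?_getD]

/-- A shifted gate read against `pre ++ degs` has the formal degree it has against `degs`. [cite: Burgisser2006, §2.2] -/
theorem Gate.formalDegree_shift_append (pre degs : List ℕ) (g : Gate k σ) :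
    (g.shift pre.length).formalDegree (pre ++ degs) = g.formalDegree degs := by
  cases g with
  | sum args =>
    simp [Gate.shift, Gate.formalDegree, List.map_map, Function.comp_def, Operand.formalDegree_shift_append]
  | prod args =>
    simp [Gate.shift, Gate.formalDegree, List.map_map, Function.comp_def, Operand.formalDegree_shift_append]

/-- The left fold of formal degrees over shifted gates with a prefix. [folklore] -/
theorem foldl_formalDegree_shift (pre : List ℕ) (gs : List (Gate k σ)) (degs : List ℕ) :
    (gs.map (Gate.shift pre.length)).foldl (fun degs g => degs ++ [g.formalDegree degs]) (pre ++ degs)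
      = pre ++ gs.foldl (fun degs g => degs ++ [g.formalDegree degs]) degs := by
  induction gs generalizing degs with
  | nil => simp
  | cons g rest ih =>
    simp only [List.map_cons, List.foldl_cons]
    rw [Gate.formalDegree_shift_append, List.append_assoc, ih]

/-- **The formal degrees of a juxtaposition are the concatenation of the formal degrees**
(formal-degree twin of `gateValues_append_shift`). [cite: Burgisser2006, §2.2] -/
theorem gateFormalDegrees_append_shift (gs gs' : List (Gate k σ)) :
    gateFormalDegrees (gs ++ gs'.map (Gate.shift gs.length)) = gateFormalDegrees gs ++ gateFormalDegrees gs' := by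
  have h : gs.length = (gateFormalDegrees gs).length := (gateFormalDegrees_length gs).symm
  unfold gateFormalDegrees
  rw [List.foldl_append, h]
  have := foldl_formalDegree_shift (k := k) (σ := σ) (gateFormalDegrees gs) gs' []
  simpa [gateFormalDegrees] using this

/-- **Formal degree of the sum combinator**: the maximum. [cite: Burgisser2006, §2.2] -/
theorem formalDegree_add [CommSemiring k] (P Q : ArithCircuit k σ) :
    (P.add Q).formalDegree = max P.formalDegree Q.formalDegree := by
  have hP := gateFormalDegrees_length (k := k) P.gates
  have hQ := gateFormalDegrees_length (k := k) Q.gates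
  have h1 := Operand.formalDegree_truncate_append (k := k) (gateFormalDegrees P.gates)
    (gateFormalDegrees Q.gates) P.output
  have h2 := Operand.formalDegree_shift_append (k := k) (gateFormalDegrees P.gates)
    (gateFormalDegrees Q.gates) Q.output
  rw [hP] at h1 h2
  have hg : gateFormalDegrees (P.add Q).gates =
      (gateFormalDegrees P.gates ++ gateFormalDegrees Q.gates) ++
        [max P.formalDegree Q.formalDegree] := by
    simp only [ArithCircuit.add, ArithCircuit.append, gateFormalDegrees_append_singleton,
      gateFormalDegrees_append_shift, size]
    congr 1
    simp [Gate.formalDegree, h1, h2, formalDegree]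
  simp only [formalDegree, ArithCircuit.add, Operand.formalDegree, List.getD_eq_getElem?_getD] at hg ⊢
  rw [hg, List.getElem?_append_right (by simp [size, hP, hQ])]
  simp [size, hP, hQ]

/-- **Formal degree of the product combinator**: the sum. [cite: Burgisser2006, §2.2] -/
theorem formalDegree_mul [Zero k] (P Q : ArithCircuit k σ) :
    (P.mul Q).formalDegree = P.formalDegree + Q.formalDegree := by
  have hP := gateFormalDegrees_length (k := k) P.gates
  have hQ := gateFormalDegrees_length (k := k) Q.gates
  have h1 := Operand.formalDegree_truncate_append (k := k) (gateFormalDegrees P.gates)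
    (gateFormalDegrees Q.gates) P.output
  have h2 := Operand.formalDegree_shift_append (k := k) (gateFormalDegrees P.gates)
    (gateFormalDegrees Q.gates) Q.output
  rw [hP] at h1 h2
  have hg : gateFormalDegrees (P.mul Q).gates =
      (gateFormalDegrees P.gates ++ gateFormalDegrees Q.gates) ++
        [P.formalDegree + Q.formalDegree] := by
    simp only [ArithCircuit.mul, ArithCircuit.append, gateFormalDegrees_append_singleton,
      gateFormalDegrees_append_shift, size]
    congr 1
    simp [Gate.formalDegree, h1, h2, formalDegree]
  simp only [formalDegree, ArithCircuit.mul, Operand.formalDegree, List.getD_eq_getElem?_getD] at hg ⊢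
  rw [hg, List.getElem?_append_right (by simp [size, hP, hQ])]
  simp [size, hP, hQ]

/-- **Formal degree of the scaling combinator**: unchanged. [cite: Burgisser2006, §2.2] -/
theorem formalDegree_smul (c : k) (P : ArithCircuit k σ) : (P.smul c).formalDegree = P.formalDegree := by
  have hP := gateFormalDegrees_length (k := k) P.gates
  simp [formalDegree, ArithCircuit.smul, gateFormalDegrees_append_singleton, Gate.formalDegree,
    Operand.formalDegree, List.getD_eq_getElem?_getD, size, hP]

end ArithCircuit

/-! ### Circuits of bounded size and formal degree -/

section TauDeg

variable {σ : Type v} {τ : Type w}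

open ArithCircuit

/-- `HasTauDeg f s d`: the integer polynomial `f` is computed by a fan-in-two, constant-free
(`HasSignConstants`) arithmetic circuit of size at most `s` and formal degree at most `d` — the
two measures bounding membership in `VP⁰` (Bürgisser 2009, Def. 2.7). [cite: Burgisser2006, Def. 2.7] -/
def HasTauDeg (f : MvPolynomial σ ℤ) (s d : ℕ) : Prop :=
  ∃ P : ArithCircuit ℤ σ, P.IsFanInTwo ∧ P.HasSignConstants ∧ P.eval = f ∧ P.size ≤ s ∧ P.formalDegree ≤ d

namespace HasTauDeg

/-- Monotonicity in both bounds. [folklore] -/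
theorem mono {f : MvPolynomial σ ℤ} {s d s' d' : ℕ} (h : HasTauDeg f s d) (hs : s ≤ s') (hd : d ≤ d') :
    HasTauDeg f s' d' := by
  obtain ⟨P, h1, h2, h3, h4, h5⟩ := h
  exact ⟨P, h1, h2, h3, h4.trans hs, h5.trans hd⟩

/-- `τ f ≤ s` for `HasTauDeg f s d`. [cite: Burgisser2006, Def. 2.7] -/
theorem constantFreeComplexity_le {f : MvPolynomial σ ℤ} {s d : ℕ} (h : HasTauDeg f s d) :
    constantFreeComplexity f ≤ s := by
  obtain ⟨P, h1, h2, h3, h4, -⟩ := h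
  exact (constantFreeComplexity_le_size h1 h2 h3).trans h4

/-- Variables: size `0`, formal degree `1`. [cite: Burgisser2006, §2.2] -/
theorem X (i : σ) : HasTauDeg (MvPolynomial.X i : MvPolynomial σ ℤ) 0 1 :=
  ⟨ofVar i, IsFanInTwo.ofVar i, HasSignConstants.ofVar i, rfl, le_rfl, le_rfl⟩

/-- Sign constants `c ∈ {0, 1, -1}`: size `0`, formal degree `1`. [cite: Burgisser2006, §2.2] -/
theorem C {c : ℤ} (hc : IsSignConstant c) : HasTauDeg (MvPolynomial.C c : MvPolynomial σ ℤ) 0 1 :=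
  ⟨ofConst c, IsFanInTwo.ofConst c, (hasSignConstants_ofConst_iff c).2 hc, rfl, le_rfl, le_rfl⟩

/-- `1`. [cite: Burgisser2006, §2.2] -/
theorem one : HasTauDeg (1 : MvPolynomial σ ℤ) 0 1 := by
  simpa using C (σ := σ) isSignConstant_one

/-- `0`. [cite: Burgisser2006, §2.2] -/
theorem zero : HasTauDeg (0 : MvPolynomial σ ℤ) 0 1 := by
  simpa using C (σ := σ) isSignConstant_zero

/-- **Sums**: `(s₁ + s₂ + 1, max d₁ d₂)`. [cite: Burgisser2006, §2.2] -/
theorem add {f g : MvPolynomial σ ℤ} {s₁ d₁ s₂ d₂ : ℕ} (hf : HasTauDeg f s₁ d₁) (hg : HasTauDeg g s₂ d₂) :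
    HasTauDeg (f + g) (s₁ + s₂ + 1) (max d₁ d₂) := by
  obtain ⟨P, hP1, hP2, hP3, hP4, hP5⟩ := hf
  obtain ⟨Q, hQ1, hQ2, hQ3, hQ4, hQ5⟩ := hg
  refine ⟨P.add Q, hP1.add hQ1, hP2.add hQ2, by rw [add_eval, hP3, hQ3], ?_, ?_⟩
  · rw [size_add]; omega
  · rw [formalDegree_add]; exact max_le_max hP5 hQ5

/-- **Products**: `(s₁ + s₂ + 1, d₁ + d₂)`. [cite: Burgisser2006, §2.2] -/
theorem mul {f g : MvPolynomial σ ℤ} {s₁ d₁ s₂ d₂ : ℕ} (hf : HasTauDeg f s₁ d₁) (hg : HasTauDeg g s₂ d₂) :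
    HasTauDeg (f * g) (s₁ + s₂ + 1) (d₁ + d₂) := by
  obtain ⟨P, hP1, hP2, hP3, hP4, hP5⟩ := hf
  obtain ⟨Q, hQ1, hQ2, hQ3, hQ4, hQ5⟩ := hg
  refine ⟨P.mul Q, hP1.mul hQ1, hP2.mul hQ2, by rw [mul_eval, hP3, hQ3], ?_, ?_⟩
  · rw [size_mul]; omega
  · rw [formalDegree_mul]; exact Nat.add_le_add hP5 hQ5

/-- **Negation**: `(s + 1, d)` (one sum gate with coefficient `-1`). [cite: Burgisser2006, §2.2] -/
theorem neg {f : MvPolynomial σ ℤ} {s d : ℕ} (hf : HasTauDeg f s d) : HasTauDeg (-f) (s + 1) d := by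
  obtain ⟨P, hP1, hP2, hP3, hP4, hP5⟩ := hf
  refine ⟨P.smul (-1), hP1.smul, hP2.smul isSignConstant_neg_one, ?_, ?_, ?_⟩
  · rw [eval_smul, hP3, neg_one_smul]
  · rw [size_smul]; omega
  · rw [formalDegree_smul]; exact hP5

/-- **Differences**: `(s₁ + s₂ + 2, max d₁ d₂)`. [cite: Burgisser2006, §2.2] -/
theorem sub {f g : MvPolynomial σ ℤ} {s₁ d₁ s₂ d₂ : ℕ} (hf : HasTauDeg f s₁ d₁) (hg : HasTauDeg g s₂ d₂) :
    HasTauDeg (f - g) (s₁ + s₂ + 2) (max d₁ d₂) := by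
  have h := hf.add hg.neg
  rw [← sub_eq_add_neg] at h
  exact h.mono (by omega) le_rfl

/-- `1 - f`: `(s + 2, max 1 d)`. [cite: Burgisser2006, §2.2] -/
theorem one_sub {f : MvPolynomial σ ℤ} {s d : ℕ} (hf : HasTauDeg f s d) : HasTauDeg (1 - f) (s + 2) (max 1 d) := by
  simpa using one.sub hf

/-- **Renaming** variables keeps size and formal degree. [cite: Burgisser2006, §2.2] -/
theorem rename {f : MvPolynomial σ ℤ} {s d : ℕ} (hf : HasTauDeg f s d) (e : σ → τ) :
    HasTauDeg (MvPolynomial.rename e f) s d := by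
  obtain ⟨P, hP1, hP2, hP3, hP4, hP5⟩ := hf
  refine ⟨P.rename e, hP1.rename e, hP2.rename e, ?_, by rw [size_rename]; exact hP4,
    by rw [formalDegree_rename]; exact hP5⟩
  rw [eval_rename_apply, hP3]

/-- **Finite sums** with uniform bounds: `∑_{i ∈ t} fᵢ` has size `≤ ∑ sᵢ + |t|` and formal degree
`≤ max 1 d` if every `fᵢ` has `(sᵢ, d)`. [cite: Burgisser2006, §2.2] -/
theorem finset_sum {ι : Type*} (t : Finset ι) {f : ι → MvPolynomial σ ℤ} {s : ι → ℕ} {d : ℕ}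
    (h : ∀ i ∈ t, HasTauDeg (f i) (s i) d) :
    HasTauDeg (∑ i ∈ t, f i) (∑ i ∈ t, s i + t.card) (max 1 d) := by
  classical
  induction t using Finset.induction_on with
  | empty => simpa using (zero (σ := σ)).mono le_rfl (le_max_left 1 d)
  | insert a t ha ih =>
    rw [Finset.sum_insert ha, Finset.sum_insert ha, Finset.card_insert_of_notMem ha]
    have h1 := (h a (Finset.mem_insert_self a t)).add (ih fun i hi => h i (Finset.mem_insert_of_mem hi))
    exact h1.mono (by omega) (by omega)

/-- **Finite products** with uniform bounds: `∏_{i ∈ t} fᵢ` has size `≤ ∑ sᵢ + |t|` and formal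
degree `≤ |t| · d + 1` if every `fᵢ` has `(sᵢ, d)`. [cite: Burgisser2006, §2.2] -/
theorem finset_prod {ι : Type*} (t : Finset ι) {f : ι → MvPolynomial σ ℤ} {s : ι → ℕ} {d : ℕ}
    (h : ∀ i ∈ t, HasTauDeg (f i) (s i) d) :
    HasTauDeg (∏ i ∈ t, f i) (∑ i ∈ t, s i + t.card) (t.card * d + 1) := by
  classical
  induction t using Finset.induction_on with
  | empty => simpa using one (σ := σ)
  | insert a t ha ih =>
    rw [Finset.prod_insert ha, Finset.sum_insert ha, Finset.card_insert_of_notMem ha]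
    have h1 := (h a (Finset.mem_insert_self a t)).mul (ih fun i hi => h i (Finset.mem_insert_of_mem hi))
    refine h1.mono (by omega) ?_
    rw [add_mul, one_mul]; omega

/-- The constant `2 = 1 + 1`: `(1, 1)`. [cite: Burgisser2006, §2.2] -/
theorem two : HasTauDeg (2 : MvPolynomial σ ℤ) 1 1 := by
  have h := one.add (one (σ := σ))
  rw [one_add_one_eq_two] at h
  simpa using h

/-- Natural-number powers by iterated multiplication: `f ^ m` has `(m s + m, m d + 1)`. [cite: Burgisser2006, §2.2] -/
theorem pow {f : MvPolynomial σ ℤ} {s d : ℕ} (hf : HasTauDeg f s d) (m : ℕ) :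
    HasTauDeg (f ^ m) (m * s + m) (m * d + 1) := by
  induction m with
  | zero => simpa using one (σ := σ)
  | succ m ih =>
    rw [pow_succ]
    refine (ih.mul hf).mono ?_ ?_
    · rw [Nat.succ_mul]; omega
    · rw [Nat.succ_mul]; omega

end HasTauDeg

end TauDeg

end Literature.Computability.AlgebraicComplexity
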